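import Literature.MeasureTheory.Group.InvariantQuotientPiTopFactor     -- ★ p850180 (LH3-p03 (g3)): `quotientMeasure_top_univ`, `isInvInvariant_prod`, `isClosed_coe_top`; brings ★ PiNormalized ∕ ProdNormalized ∕ Transport
import HarnessLib

/-!
# `(A × B) ⧸ M ≃ₜ Π_i (G_i ⧸ M_i)` with `M ↔ (Π_i M_i) × B`, and the quotient measure IS the product of the local quotient measures
(Folland, *A Course in Abstract Harmonic Analysis* (1995), §2.6 Thm. 2.49, (2.52); Deitmar–Echterhoff (2014), Thm. 1.5.3; Gelbart (1975), §10 (10.19))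

Topic `MeasureTheory/Group`; namespace `Literature.MeasureTheory.Group`; THEOREMS ONLY (no definition, no instance visible to importers, no named fact, no `sorry`).
The MEASURE-LEVEL form of ★ `exists_haar_quotientMeasure_prod_pi_top` (`InvariantQuotientPiTopFactor`): in the situation `A × B`, `eA : A ≃ₜ* Π_i G_i`, `M ≤ A × B`
closed with `(a, b) ∈ M ↔ ∀ i, (eA a)_i ∈ M_i`, product Haar measures `νH = (eA⁻¹_* ⊗ ν_i) ⊗ ν_B` and Haar `ρ_i` on the `M_i`, there are ONE inversion-invariant Haar
measure `ρ` on `M` and ONE homeomorphism `Ψ : (A × B) ⧸ M ≃ₜ Π_i (G_i ⧸ M_i)` — `Ψ((a, b) M) = ((eA a)_i M_i)_i`, the `B`-factor collapses to a point — with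
**`Ψ_* (νH ∕ ρ) = ⊗_i (ν_i ∕ ρ_i)`** (`exists_haar_homeomorph_map_quotientMeasure_prod_pi_top`; with the same (mass) clause as ★).  Every integral statement follows by
change of variables along `Ψ`, WITH integrability bookkeeping: `integral_quotientMeasure_eq_integral_pi_of_map_eq`, `lintegral_…`, `integrable_descConj_iff_of_map_eq`
(stated for any `Ψ`, `ρ` satisfying the two identities, so that consumers destructure the package once).  This is what the partial-function form (P2) of the LH3 organ
(PROD-QUOT-H) (crux `stmt-HodgeConjecture-24833`) needs beyond ★ (the Fubini split at one place requires integrability on the product).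
HONEST LABEL: pure measure theory; HC_CM is proved only modulo the printed citations until rung 0 closes and this file pays nothing by itself.

## References
* [Folland1995] G. B. Folland, *A Course in Abstract Harmonic Analysis* (1995), §2.2, §2.6 Thm. 2.49, (2.52).
* [DeitmarEchterhoff2014] A. Deitmar, S. Echterhoff, *Principles of Harmonic Analysis*, 2nd ed. (2014), Thm. 1.5.3.
* [Gelbart1975] S. Gelbart, *Automorphic forms on adele groups*, Ann. of Math. Studies 83 (1975), §10, p. 155, (10.19).
* [BorelJacquet1979] A. Borel, H. Jacquet, *Automorphic forms and automorphic representations*, PSPM 33.1 (1979), §4.1.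
-/

set_option autoImplicit false

noncomputable section

open MeasureTheory MeasureTheory.Measure Topology
open scoped NNReal ENNReal

namespace Literature.MeasureTheory.Group

/-! ### §1 Haar transport along restrictions of isomorphisms (private copies) -/

section Helpers

variable {G G' : Type*} [Group G] [Group G'] [TopologicalSpace G] [TopologicalSpace G']
  [IsTopologicalGroup G] [IsTopologicalGroup G'] [MeasurableSpace G] [BorelSpace G] [MeasurableSpace G'] [BorelSpace G']
  (e : G ≃* G') (he : Continuous e) (hes : Continuous e.symm)
  (H : Subgroup G) (H' : Subgroup G') (hHH' : ∀ g, e g ∈ H' ↔ g ∈ H)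

/-- Transported Haar measures along `subgroupCongrHomeomorph` are Haar. [folklore] -/
private theorem isHaarMeasure_map_subgroupCongrHomeomorph'' [LocallyCompactSpace H] (ρ : Measure H) [IsHaarMeasure ρ] :
    IsHaarMeasure (Measure.map (subgroupCongrHomeomorph e H H' hHH' he hes) ρ) := by
  let f : H ≃* H' :=
    { toFun := fun h => ⟨e h, (hHH' h).2 h.2⟩
      invFun := fun h' => ⟨e.symm h', (forall_symm_mem_iff e H H' hHH' h').2 h'.2⟩
      left_inv := fun h => Subtype.ext (e.symm_apply_apply h)
      right_inv := fun h' => Subtype.ext (e.apply_symm_apply h')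
      map_mul' := fun a b => Subtype.ext (by simp only [Subgroup.coe_mul, map_mul]) }
  have hf : ⇑f = ⇑(subgroupCongrHomeomorph e H H' hHH' he hes) := rfl
  have h := MulEquiv.isHaarMeasure_map ρ f (hf ▸ (subgroupCongrHomeomorph e H H' hHH' he hes).continuous)
    (by
      have : ⇑f.symm = ⇑(subgroupCongrHomeomorph e H H' hHH' he hes).symm := rfl
      rw [this]; exact (subgroupCongrHomeomorph e H H' hHH' he hes).symm.continuous)
  rwa [hf] at h

/-- … and inversion invariant. [folklore] -/
private theorem isInvInvariant_map_subgroupCongrHomeomorph'' (ρ : Measure H) [ρ.IsInvInvariant] :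
    (Measure.map (subgroupCongrHomeomorph e H H' hHH' he hes) ρ).IsInvInvariant := by
  let f : H ≃* H' :=
    { toFun := fun h => ⟨e h, (hHH' h).2 h.2⟩
      invFun := fun h' => ⟨e.symm h', (forall_symm_mem_iff e H H' hHH' h').2 h'.2⟩
      left_inv := fun h => Subtype.ext (e.symm_apply_apply h)
      right_inv := fun h' => Subtype.ext (e.apply_symm_apply h')
      map_mul' := fun a b => Subtype.ext (by simp only [Subgroup.coe_mul, map_mul]) }
  have hf : ⇑f = ⇑(subgroupCongrHomeomorph e H H' hHH' he hes) := rfl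
  have h := isInvInvariant_map_mulEquiv f (hf ▸ (subgroupCongrHomeomorph e H H' hHH' he hes).continuous.measurable) ρ
  rwa [hf] at h

end Helpers

/-! ### §2 The package at the level of measures -/

section PiTopMap

variable {ι : Type*} [Fintype ι]
  {Gi : ι → Type*} [∀ i, Group (Gi i)] [∀ i, TopologicalSpace (Gi i)] [∀ i, IsTopologicalGroup (Gi i)]
  [∀ i, LocallyCompactSpace (Gi i)] [∀ i, SecondCountableTopology (Gi i)] [∀ i, T2Space (Gi i)]
  [∀ i, MeasurableSpace (Gi i)] [∀ i, BorelSpace (Gi i)]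
  {A B : Type*} [Group A] [Group B] [TopologicalSpace A] [TopologicalSpace B]
  [IsTopologicalGroup A] [IsTopologicalGroup B] [LocallyCompactSpace A] [LocallyCompactSpace B]
  [SecondCountableTopology A] [SecondCountableTopology B] [T2Space A] [T2Space B]
  [MeasurableSpace A] [BorelSpace A] [MeasurableSpace B] [BorelSpace B]
  (eA : A ≃ₜ* (∀ i, Gi i))
  (Mi : ∀ i, Subgroup (Gi i)) (hMi : ∀ i, IsClosed (Mi i : Set (Gi i)))
  (M : Subgroup (A × B)) (hM : IsClosed (M : Set (A × B)))
  (hmem : ∀ p : A × B, p ∈ M ↔ ∀ i, eA p.1 i ∈ Mi i)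
  (ρi : ∀ i, Measure (Mi i)) [∀ i, (ρi i).IsHaarMeasure] [∀ i, (ρi i).IsInvInvariant] [∀ i, SigmaFinite (ρi i)]
  (νi : ∀ i, Measure (Gi i)) [∀ i, IsHaarMeasure (νi i)] [∀ i, (νi i).IsMulRightInvariant]
  (νB : Measure B) [IsHaarMeasure νB] [νB.IsMulRightInvariant] [νB.IsInvInvariant]
  (νH : Measure (A × B)) [IsHaarMeasure νH] [νH.IsMulRightInvariant]
  (hν : νH = ((Measure.pi νi).map eA.symm).prod νB)
  [MeasurableSpace ((A × B) ⧸ M)] [BorelSpace ((A × B) ⧸ M)]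
  [∀ i, MeasurableSpace (Gi i ⧸ Mi i)] [∀ i, BorelSpace (Gi i ⧸ Mi i)]

include hMi hmem hν in
/-- **THE PACKAGE AT THE LEVEL OF MEASURES.**  In the situation of ★ `exists_haar_quotientMeasure_prod_pi_top` (`(a, b) ∈ M ↔ ∀ i, (eA a)_i ∈ M_i`; product Haar
measures) there are ONE inversion-invariant Haar measure `ρ` on `M` and ONE homeomorphism `Ψ : (A × B) ⧸ M ≃ₜ Π_i (G_i ⧸ M_i)`, `Ψ((a,b)M) = ((eA a)_i M_i)_i` (the factor
`B ≤ M` collapses), such that (mass) `ρ {m | ∀ i, (eA m.1)_i ∈ K_i} = (Π_i ρ_i K_i) · ν_B(B)` and **`Ψ_* (νH ∕ ρ) = ⊗_i (ν_i ∕ ρ_i)`** — the canonical quotient measure IS the product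
of the local ones (★ `map_cosetCongr_quotientMeasure`, ★ `map_quotientProdHomeomorph_quotientMeasure_prod`, ★ `map_quotientPiHomeomorph_quotientMeasure_pi`, ★ `quotientMeasure_top_univ`,
all with constant `1`). [cite: Folland1995, §2.6 Thm. 2.49, (2.52)] [cite: DeitmarEchterhoff2014, Thm. 1.5.3] [cite: Gelbart1975, p. 155 (10.19)] [cite: BorelJacquet1979, §4.1] -/
theorem exists_haar_homeomorph_map_quotientMeasure_prod_pi_top :
    ∃ (ρ : Measure M) (_ : ρ.IsHaarMeasure) (_ : ρ.IsInvInvariant) (Ψ : (A × B) ⧸ M ≃ₜ (∀ i, Gi i ⧸ Mi i)),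
      (∀ K : ∀ i, Set (Mi i),
        ρ {m : M | ∀ i, (⟨eA (m : A × B).1 i, (hmem _).1 m.2 i⟩ : Mi i) ∈ K i} = (∏ i, ρi i (K i)) * νB Set.univ) ∧
      (∀ (a : A) (b : B), Ψ (QuotientGroup.mk (a, b)) = fun i => (QuotientGroup.mk (eA a i) : Gi i ⧸ Mi i)) ∧
      (∀ x : ∀ i, Gi i, Ψ.symm (fun i => (QuotientGroup.mk (x i) : Gi i ⧸ Mi i)) = QuotientGroup.mk (eA.symm x, (1 : B))) ∧
      Measure.map Ψ (quotientMeasure M ρ hM νH) = Measure.pi fun i => quotientMeasure (Mi i) (ρi i) (hMi i) (νi i) := by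
  classical
  haveI : ∀ i, LocallyCompactSpace (Mi i) := fun i => (hMi i).isClosedEmbedding_subtypeVal.locallyCompactSpace
  haveI hMc : IsClosed (M : Set (A × B)) := hM
  haveI : LocallyCompactSpace M := hM.isClosedEmbedding_subtypeVal.locallyCompactSpace
  haveI : ∀ i, IsClosed (Mi i : Set (Gi i)) := hMi
  -- `e : (Π G_i) × B ≃* A × B`
  set e : (∀ i, Gi i) × B ≃* A × B := eA.symm.toMulEquiv.prodCongr (MulEquiv.refl B) with he_def
  have he_apply : ∀ p : (∀ i, Gi i) × B, e p = (eA.symm p.1, p.2) := fun p => rfl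
  have he : Continuous e := (eA.symm.continuous.comp continuous_fst).prodMk continuous_snd
  have hes : Continuous e.symm := (eA.continuous.comp continuous_fst).prodMk continuous_snd
  -- `M' = (Π M_i) × ⊤`
  have hπc : IsClosed ((Subgroup.pi Set.univ Mi : Subgroup (∀ i, Gi i)) : Set (∀ i, Gi i)) := isClosed_coe_pi Mi hMi
  haveI : IsClosed ((Subgroup.pi Set.univ Mi : Subgroup (∀ i, Gi i)) : Set (∀ i, Gi i)) := hπc
  haveI hTc : IsClosed ((⊤ : Subgroup B) : Set B) := isClosed_coe_top
  have hM'c : IsClosed (((Subgroup.pi Set.univ Mi).prod (⊤ : Subgroup B) : Subgroup ((∀ i, Gi i) × B)) : Set ((∀ i, Gi i) × B)) :=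
    isClosed_coe_prod _ _ hπc hTc
  haveI : IsClosed (((Subgroup.pi Set.univ Mi).prod (⊤ : Subgroup B) : Subgroup ((∀ i, Gi i) × B)) : Set ((∀ i, Gi i) × B)) := hM'c
  have hHH' : ∀ p : (∀ i, Gi i) × B, e p ∈ M ↔ p ∈ (Subgroup.pi Set.univ Mi).prod (⊤ : Subgroup B) := fun p => by
    rw [hmem, he_apply, Subgroup.mem_prod, Subgroup.mem_pi]
    simp only [ContinuousMulEquiv.apply_symm_apply, Set.mem_univ, forall_const, Subgroup.mem_top, and_true]
  -- Borel structures on the intermediate coset spaces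
  letI : MeasurableSpace ((∀ i, Gi i) ⧸ Subgroup.pi Set.univ Mi) := borel _
  haveI : BorelSpace ((∀ i, Gi i) ⧸ Subgroup.pi Set.univ Mi) := ⟨rfl⟩
  letI : MeasurableSpace (B ⧸ (⊤ : Subgroup B)) := borel _
  haveI : BorelSpace (B ⧸ (⊤ : Subgroup B)) := ⟨rfl⟩
  letI : MeasurableSpace (((∀ i, Gi i) × B) ⧸ (Subgroup.pi Set.univ Mi).prod (⊤ : Subgroup B)) := borel _
  haveI : BorelSpace (((∀ i, Gi i) × B) ⧸ (Subgroup.pi Set.univ Mi).prod (⊤ : Subgroup B)) := ⟨rfl⟩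
  -- (a) `Π M_i`
  let eπ : (Subgroup.pi Set.univ Mi) ≃ₜ* (∀ i, Mi i) :=
    { subgroupPiCoords Mi with
      continuous_toFun := (subgroupPiHomeomorph Mi).continuous
      continuous_invFun := (subgroupPiHomeomorph Mi).symm.continuous }
  have heπ : (⇑eπ : (Subgroup.pi Set.univ Mi) → ∀ i, Mi i) = subgroupPiCoords Mi := rfl
  set ρπ : Measure (Subgroup.pi Set.univ Mi) := (Measure.pi ρi).map eπ.symm with hρπ_def
  haveI : LocallyCompactSpace (Subgroup.pi Set.univ Mi) := hπc.isClosedEmbedding_subtypeVal.locallyCompactSpace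
  haveI : ρπ.IsHaarMeasure := eπ.symm.isHaarMeasure_map _
  haveI : ρπ.IsInvInvariant := isInvInvariant_map_mulEquiv eπ.symm.toMulEquiv eπ.symm.continuous.measurable _
  have hρπ : Measure.map (subgroupPiCoords Mi) ρπ = Measure.pi ρi := by
    rw [hρπ_def, ← heπ, Measure.map_map (show Measurable (⇑eπ : (Subgroup.pi Set.univ Mi) → ∀ i, Mi i) from eπ.continuous.measurable)
      (show Measurable (⇑eπ.symm : (∀ i, Mi i) → (Subgroup.pi Set.univ Mi)) from eπ.symm.continuous.measurable)]
    have : (⇑eπ : (Subgroup.pi Set.univ Mi) → ∀ i, Mi i) ∘ ⇑eπ.symm = id := funext fun x => eπ.apply_symm_apply x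
    rw [this, Measure.map_id]
  -- (b) `ν_B` on `⊤ ≤ B`
  let eT : (⊤ : Subgroup B) ≃ₜ* B :=
    { Subgroup.topEquiv with
      continuous_toFun := continuous_subtype_val
      continuous_invFun := continuous_id.subtype_mk _ }
  set ρT : Measure (⊤ : Subgroup B) := νB.map eT.symm with hρT_def
  haveI : LocallyCompactSpace (⊤ : Subgroup B) := hTc.isClosedEmbedding_subtypeVal.locallyCompactSpace
  haveI : ρT.IsHaarMeasure := eT.symm.isHaarMeasure_map _
  haveI : ρT.IsInvInvariant := isInvInvariant_map_mulEquiv eT.symm.toMulEquiv eT.symm.continuous.measurable _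
  have hρT : Measure.map ((⊤ : Subgroup B).subtype : (⊤ : Subgroup B) → B) ρT = νB := by
    rw [hρT_def, Measure.map_map (show Measurable ((⊤ : Subgroup B).subtype : (⊤ : Subgroup B) → B) from continuous_subtype_val.measurable)
      (show Measurable (⇑eT.symm : B → (⊤ : Subgroup B)) from eT.symm.continuous.measurable)]
    have : ((⊤ : Subgroup B).subtype : (⊤ : Subgroup B) → B) ∘ ⇑eT.symm = id := funext fun _ => rfl
    rw [this, Measure.map_id]
  have hρT_univ : ρT Set.univ = νB Set.univ := by
    rw [hρT_def, Measure.map_apply (show Measurable (⇑eT.symm : B → (⊤ : Subgroup B)) from eT.symm.continuous.measurable) MeasurableSet.univ,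
      Set.preimage_univ]
  -- (c) `M'`
  let ep : ((Subgroup.pi Set.univ Mi).prod (⊤ : Subgroup B)) ≃ₜ* (Subgroup.pi Set.univ Mi) × (⊤ : Subgroup B) :=
    { Subgroup.prodEquiv (Subgroup.pi Set.univ Mi) (⊤ : Subgroup B) with
      continuous_toFun := ((continuous_fst.comp continuous_subtype_val).subtype_mk _).prodMk ((continuous_snd.comp continuous_subtype_val).subtype_mk _)
      continuous_invFun := ((continuous_subtype_val.comp continuous_fst).prodMk (continuous_subtype_val.comp continuous_snd)).subtype_mk _ }
  have hep : (⇑ep : _ → _) = Subgroup.prodEquiv (Subgroup.pi Set.univ Mi) (⊤ : Subgroup B) := rfl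
  set ρp : Measure ((Subgroup.pi Set.univ Mi).prod (⊤ : Subgroup B)) := (ρπ.prod ρT).map ep.symm with hρp_def
  haveI : (ρπ.prod ρT).IsInvInvariant := isInvInvariant_prod ρπ ρT
  haveI : LocallyCompactSpace ((Subgroup.pi Set.univ Mi).prod (⊤ : Subgroup B)) := hM'c.isClosedEmbedding_subtypeVal.locallyCompactSpace
  haveI : ρp.IsHaarMeasure := ep.symm.isHaarMeasure_map _
  haveI : ρp.IsInvInvariant := isInvInvariant_map_mulEquiv ep.symm.toMulEquiv ep.symm.continuous.measurable _
  have hρp : Measure.map (Subgroup.prodEquiv (Subgroup.pi Set.univ Mi) (⊤ : Subgroup B)) ρp = ρπ.prod ρT := by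
    rw [hρp_def, ← hep, Measure.map_map (show Measurable (⇑ep : ((Subgroup.pi Set.univ Mi).prod (⊤ : Subgroup B)) → (Subgroup.pi Set.univ Mi) × (⊤ : Subgroup B)) from ep.continuous.measurable)
      (show Measurable (⇑ep.symm : (Subgroup.pi Set.univ Mi) × (⊤ : Subgroup B) → ((Subgroup.pi Set.univ Mi).prod (⊤ : Subgroup B))) from ep.symm.continuous.measurable)]
    have : (⇑ep : _ → _) ∘ ⇑ep.symm = id := funext fun x => ep.apply_symm_apply x
    rw [this, Measure.map_id]
  -- (d) `ρ` on `M`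
  set ρ : Measure M := ρp.map (subgroupCongrHomeomorph e _ M hHH' he hes) with hρ_def
  haveI hρH : ρ.IsHaarMeasure := isHaarMeasure_map_subgroupCongrHomeomorph'' e he hes _ M hHH' ρp
  haveI hρI : ρ.IsInvInvariant := isInvInvariant_map_subgroupCongrHomeomorph'' e he hes _ M hHH' ρp
  -- (e) `νH` in product coordinates and the transport identity
  have hν' : νH = Measure.map e ((Measure.pi νi).prod νB) := by
    rw [hν]
    have h1 : (⇑e : (∀ i, Gi i) × B → A × B) = Prod.map eA.symm id := funext fun p => rfl
    rw [h1, ← Measure.map_prod_map _ _ (show Measurable (⇑eA.symm : (∀ i, Gi i) → A) from eA.symm.continuous.measurable) measurable_id, Measure.map_id]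
  have hT := map_cosetCongr_quotientMeasure e he hes ((Subgroup.pi Set.univ Mi).prod (⊤ : Subgroup B)) M hHH' ρp ρ ((Measure.pi νi).prod νB) νH rfl hν'
  -- the homeomorphism `Ψ`
  haveI : Subsingleton (B ⧸ (⊤ : Subgroup B)) := QuotientGroup.subsingleton_quotient_top
  letI : Unique (B ⧸ (⊤ : Subgroup B)) := uniqueOfSubsingleton ((1 : B) : B ⧸ (⊤ : Subgroup B))
  let Ψ : (A × B) ⧸ M ≃ₜ (∀ i, Gi i ⧸ Mi i) :=
    (((cosetCongrHomeomorph e _ M hHH' he hes).symm.trans (quotientProdHomeomorph (Subgroup.pi Set.univ Mi) (⊤ : Subgroup B))).trans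
      ((quotientPiHomeomorph Mi).prodCongr (Homeomorph.refl (B ⧸ (⊤ : Subgroup B))))).trans (Homeomorph.prodUnique _ _)
  have hΨ : ∀ (a : A) (b : B), Ψ (QuotientGroup.mk (a, b)) = fun i => (QuotientGroup.mk (eA a i) : Gi i ⧸ Mi i) := by
    intro a b
    simp only [Ψ, Homeomorph.trans_apply, Homeomorph.coe_prodUnique, Homeomorph.coe_prodCongr, Homeomorph.refl_apply, Prod.map_fst]
    have h1 : (cosetCongrHomeomorph e _ M hHH' he hes).symm (QuotientGroup.mk (a, b)) = QuotientGroup.mk (e.symm (a, b)) := rfl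
    rw [h1, coe_quotientProdHomeomorph, prodEquiv_mk, coe_quotientPiHomeomorph, quotientPiEquiv_mk]
    rfl
  have hΨsymm : ∀ x : ∀ i, Gi i, Ψ.symm (fun i => (QuotientGroup.mk (x i) : Gi i ⧸ Mi i)) = QuotientGroup.mk (eA.symm x, (1 : B)) := by
    intro x
    rw [Homeomorph.symm_apply_eq, hΨ]
    simp only [ContinuousMulEquiv.apply_symm_apply]
  -- the measure identity
  have hmap : Measure.map Ψ (quotientMeasure M ρ hM νH) = Measure.pi fun i => quotientMeasure (Mi i) (ρi i) (hMi i) (νi i) := by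
    -- step 1: back to `M'`
    have h1 : Measure.map (cosetCongrHomeomorph e _ M hHH' he hes).symm (quotientMeasure M ρ hM νH) =
        quotientMeasure ((Subgroup.pi Set.univ Mi).prod (⊤ : Subgroup B)) ρp hM'c ((Measure.pi νi).prod νB) := by
      rw [← hT, ← coe_cosetCongrHomeomorph e _ M hHH' he hes,
        Measure.map_map (cosetCongrHomeomorph e _ M hHH' he hes).symm.measurable (cosetCongrHomeomorph e _ M hHH' he hes).measurable,
        Homeomorph.symm_comp_self, Measure.map_id]
    -- step 2: the binary split
    have h2 := map_quotientProdHomeomorph_quotientMeasure_prod (Subgroup.pi Set.univ Mi) (⊤ : Subgroup B) ρπ ρT ρp hρp (Measure.pi νi) νB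
    -- step 3: the finite product and the one-point factor
    have h3 := map_quotientPiHomeomorph_quotientMeasure_pi Mi hMi ρi ρπ hρπ νi
    have h4 : quotientMeasure (⊤ : Subgroup B) ρT hTc νB = Measure.dirac ((1 : B) : B ⧸ (⊤ : Subgroup B)) := by
      refine Measure.ext fun s _ => ?_
      by_cases h : ((1 : B) : B ⧸ (⊤ : Subgroup B)) ∈ s
      · have hs : s = Set.univ := Set.eq_univ_of_forall fun y => (Subsingleton.elim ((1 : B) : B ⧸ (⊤ : Subgroup B)) y) ▸ h
        rw [hs, quotientMeasure_top_univ νB ρT hρT, Measure.dirac_apply_of_mem (Set.mem_univ _)]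
      · have hs : s = ∅ := by
          ext y
          exact ⟨fun hy => h ((Subsingleton.elim y ((1 : B) : B ⧸ (⊤ : Subgroup B))) ▸ hy), fun hy => hy.elim⟩
        rw [hs, measure_empty, measure_empty]
    haveI : ∀ i, SigmaFinite (quotientMeasure (Mi i) (ρi i) (hMi i) (νi i)) := fun i => inferInstance
    have hΨfun : (⇑Ψ : (A × B) ⧸ M → ∀ i, Gi i ⧸ Mi i) = (⇑(Homeomorph.prodUnique (∀ i, Gi i ⧸ Mi i) (B ⧸ (⊤ : Subgroup B)))) ∘
        (⇑((quotientPiHomeomorph Mi).prodCongr (Homeomorph.refl (B ⧸ (⊤ : Subgroup B))))) ∘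
        (⇑(quotientProdHomeomorph (Subgroup.pi Set.univ Mi) (⊤ : Subgroup B))) ∘ (⇑(cosetCongrHomeomorph e _ M hHH' he hes).symm) := rfl
    have mU := (Homeomorph.prodUnique (∀ i, Gi i ⧸ Mi i) (B ⧸ (⊤ : Subgroup B))).measurable
    have mC := ((quotientPiHomeomorph Mi).prodCongr (Homeomorph.refl (B ⧸ (⊤ : Subgroup B)))).measurable
    have mP := (quotientProdHomeomorph (Subgroup.pi Set.univ Mi) (⊤ : Subgroup B)).measurable
    have mS := (cosetCongrHomeomorph e _ M hHH' he hes).symm.measurable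
    rw [hΨfun, ← Measure.map_map mU (mC.comp (mP.comp mS)), ← Measure.map_map mC (mP.comp mS), ← Measure.map_map mP mS, h1, h2,
      Homeomorph.coe_prodCongr, ← Measure.map_prod_map _ _ (quotientPiHomeomorph Mi).measurable (Homeomorph.refl _).measurable, h3, h4]
    have hrefl : Measure.map (⇑(Homeomorph.refl (B ⧸ (⊤ : Subgroup B)))) (Measure.dirac ((1 : B) : B ⧸ (⊤ : Subgroup B))) =
        Measure.dirac ((1 : B) : B ⧸ (⊤ : Subgroup B)) := Measure.map_id
    rw [hrefl, Measure.prod_dirac, Measure.map_map mU measurable_prodMk_right, Homeomorph.coe_prodUnique]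
    exact Measure.map_id
  refine ⟨ρ, hρH, hρI, Ψ, ?_, hΨ, hΨsymm, hmap⟩
  -- (mass)
  intro K
  have hS : ρ {m : M | ∀ i, (⟨eA (m : A × B).1 i, (hmem _).1 m.2 i⟩ : Mi i) ∈ K i} =
      (ρπ.prod ρT) ({x : Subgroup.pi Set.univ Mi | ∀ i, (⟨((x : ∀ i, Gi i) i), (Subgroup.mem_pi _).1 x.2 i (Set.mem_univ i)⟩ : Mi i) ∈ K i} ×ˢ Set.univ) := by
    rw [hρ_def, ← Homeomorph.toMeasurableEquiv_coe, MeasurableEquiv.map_apply, hρp_def,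
      show Measure.map (⇑ep.symm) (ρπ.prod ρT) = Measure.map (⇑ep.symm.toHomeomorph.toMeasurableEquiv) (ρπ.prod ρT) from rfl, MeasurableEquiv.map_apply]
    congr 1
    ext x
    simp only [Set.mem_preimage, Set.mem_setOf_eq, Set.mem_prod, Set.mem_univ, and_true, Homeomorph.toMeasurableEquiv_coe]
    refine forall_congr' fun i => ?_
    have hx : eA ((subgroupCongrHomeomorph e _ M hHH' he hes (ep.symm.toHomeomorph x) : M) : A × B).1 i =
        ((x.1 : Subgroup.pi Set.univ Mi) : ∀ i, Gi i) i := by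
      rw [coe_subgroupCongrHomeomorph_apply, he_apply]
      simp only [ContinuousMulEquiv.apply_symm_apply]
      rfl
    exact ⟨fun h => by convert h using 1; exact Subtype.ext hx.symm, fun h => by convert h using 1; exact Subtype.ext hx⟩
  rw [hS, Measure.prod_prod, hρT_univ, hρπ_def,
    show Measure.map (⇑eπ.symm) (Measure.pi ρi) = Measure.map (⇑eπ.symm.toHomeomorph.toMeasurableEquiv) (Measure.pi ρi) from rfl, MeasurableEquiv.map_apply]
  congr 1
  have hset : ⇑(eπ.symm.toHomeomorph.toMeasurableEquiv) ⁻¹'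
      {x : Subgroup.pi Set.univ Mi | ∀ i, (⟨((x : ∀ i, Gi i) i), (Subgroup.mem_pi _).1 x.2 i (Set.mem_univ i)⟩ : Mi i) ∈ K i} = Set.pi Set.univ K := by
    ext y
    simp only [Set.mem_preimage, Set.mem_setOf_eq, Set.mem_pi, Set.mem_univ, forall_const, Homeomorph.toMeasurableEquiv_coe]
    refine forall_congr' fun i => ?_
    rfl
  rw [hset, Measure.pi_pi]

/-! ### §3 Consequences for ANY (`ρ`, `Ψ`) satisfying the two identities -/

variable (ρ : Measure M) [ρ.IsHaarMeasure] [ρ.IsInvInvariant] (Ψ : (A × B) ⧸ M ≃ₜ (∀ i, Gi i ⧸ Mi i))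
  (hmap : Measure.map Ψ (quotientMeasure M ρ hM νH) = Measure.pi fun i => quotientMeasure (Mi i) (ρi i) (hMi i) (νi i))

include hmap in
omit [∀ i, SigmaFinite (ρi i)] in
/-- **Change of variables along `Ψ`** (Bochner, no integrability hypothesis): `∫_{(A×B)⧸M} F d(νH∕ρ) = ∫_{Π_i G_i⧸M_i} F(Ψ⁻¹ p) d(⊗_i ν_i∕ρ_i)`.
[cite: Folland1995, §2.6 (2.52)] -/
theorem integral_quotientMeasure_eq_integral_pi_of_map_eq {E : Type*} [NormedAddCommGroup E] [NormedSpace ℝ E] (F : (A × B) ⧸ M → E) :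
    ∫ y, F y ∂(quotientMeasure M ρ hM νH) = ∫ p, F (Ψ.symm p) ∂(Measure.pi fun i => quotientMeasure (Mi i) (ρi i) (hMi i) (νi i)) := by
  rw [← hmap, ← Homeomorph.toMeasurableEquiv_coe, integral_map_equiv]
  simp only [Homeomorph.toMeasurableEquiv_coe, Homeomorph.symm_apply_apply]

include hmap in
omit [∀ i, SigmaFinite (ρi i)] in
/-- **Change of variables along `Ψ`, `[0, ∞]`-valued.** [cite: Folland1995, §2.6 (2.52)] -/
theorem lintegral_quotientMeasure_eq_lintegral_pi_of_map_eq (F : (A × B) ⧸ M → ℝ≥0∞) :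
    ∫⁻ y, F y ∂(quotientMeasure M ρ hM νH) = ∫⁻ p, F (Ψ.symm p) ∂(Measure.pi fun i => quotientMeasure (Mi i) (ρi i) (hMi i) (νi i)) := by
  rw [← hmap, ← Homeomorph.toMeasurableEquiv_coe, lintegral_map_equiv]
  simp only [Homeomorph.toMeasurableEquiv_coe, Homeomorph.symm_apply_apply]

include hmap in
omit [∀ i, SigmaFinite (ρi i)] in
/-- **Integrability transfers along `Ψ`**: `F` is integrable for `νH∕ρ` iff `F ∘ Ψ⁻¹` is integrable for `⊗_i ν_i∕ρ_i`. [cite: Folland1995, §2.6 (2.52)] -/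
theorem integrable_quotientMeasure_iff_of_map_eq {E : Type*} [NormedAddCommGroup E] (F : (A × B) ⧸ M → E) :
    Integrable F (quotientMeasure M ρ hM νH) ↔ Integrable (fun p => F (Ψ.symm p)) (Measure.pi fun i => quotientMeasure (Mi i) (ρi i) (hMi i) (νi i)) := by
  rw [← hmap]
  have h := integrable_map_equiv (μ := quotientMeasure M ρ hM νH) Ψ.toMeasurableEquiv (fun p => F (Ψ.symm p))
  rw [Homeomorph.toMeasurableEquiv_coe] at h
  rw [h]
  simp only [Function.comp_def, Homeomorph.symm_apply_apply]

end PiTopMap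

/-! ### §4 The orbital integrand in the coordinates `Ψ` -/

section Coord

variable {ι : Type*} {Gi : ι → Type*} [∀ i, Group (Gi i)] [∀ i, TopologicalSpace (Gi i)]
  {A B : Type*} [Group A] [Group B] [TopologicalSpace A] [TopologicalSpace B]
  (eA : A ≃ₜ* (∀ i, Gi i)) (Mi : ∀ i, Subgroup (Gi i)) (M : Subgroup (A × B)) (Ψ : (A × B) ⧸ M ≃ₜ (∀ i, Gi i ⧸ Mi i))

/-- **The orbital integrand in the coordinates `Ψ`**: if `Ψ⁻¹((x_i M_i)_i) = (eA⁻¹ x, 1) M` then for `γ = (eA⁻¹ γ_•, b)` commuting with `M`,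
`(y ↦ F(y γ y⁻¹))(Ψ⁻¹ p) = F(eA⁻¹ (x_i γ_i x_i⁻¹)_i, b)` with `x_i` any representatives of `p_i`. [cite: Gelbart1975, p. 155 (10.19)] -/
theorem descConj_homeomorph_symm_eq {α : Type*}
    (hΨsymm : ∀ x : ∀ i, Gi i, Ψ.symm (fun i => (QuotientGroup.mk (x i) : Gi i ⧸ Mi i)) = QuotientGroup.mk (eA.symm x, (1 : B)))
    (γi : ∀ i, Gi i) (b : B) (hγi : ∀ i, ∀ m ∈ Mi i, m * γi i = γi i * m)
    (hγ : ∀ m ∈ M, m * (eA.symm γi, b) = (eA.symm γi, b) * m) (F : A × B → α) (p : ∀ i, Gi i ⧸ Mi i) :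
    descConj (eA.symm γi, b) M hγ F (Ψ.symm p) = F (eA.symm (fun i => descConj (γi i) (Mi i) (hγi i) id (p i)), b) := by
  have hp : p = fun i => (QuotientGroup.mk (p i).out : Gi i ⧸ Mi i) := funext fun i => (QuotientGroup.out_eq' (p i)).symm
  rw [hp, hΨsymm, descConj_mk]
  simp only [Prod.mk_mul_mk, Prod.inv_mk, one_mul, inv_one, mul_one, descConj_mk, ← map_mul, ← map_inv]
  rfl

end Coord


end Literature.MeasureTheory.Group

end
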